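import Mathlib.Combinatorics.SimpleGraph.Acyclic
import Mathlib.CategoryTheory.Category.Basic
import Mathlib.CategoryTheory.Iso
import Mathlib.Data.Set.Finite.Basic
import Mathlib.SetTheory.Cardinal.Finite
import HarnessLib

/-!
# Semi-graphs ([SemiAnbd] §1, pp. 11–14)

Mochizuki, *Semi-graphs of anabelioids*, Publ. RIMS **42** (2006) 221–322, §1 "Zariski's Main
Theorem for Semi-graphs", author's manuscript pp. 11–14 [cite: MochizukiSemiAnbd2006, §1 pp.11-14]
(the notion itself is recalled there from [Mzk3] = Mochizuki, *The absolute anabelian geometry of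
canonical curves*, Appendix).  This file types the combinatorial vocabulary of §1 that everything
else in the paper (semi-graphs of anabelioids §2, temperoids §3, localizations §4) is built on:

* semi-graphs `G = {𝒱, ℰ, ζ}` (p. 11): vertices, edges, each edge a 2-element set of *branches*,
  coincidence maps `ζ_e : e → 𝒱 ∪ {𝒱}`; verticial portion / cardinality; graphs; finite and
  countable semi-graphs; components; "joins", "abuts";
* morphisms of semi-graphs (p. 11) and the category they form;
* sub-semi-graphs and embeddings (p. 12); closed / open / isolated edges, coverticial edges,
  locally finite, untangled semi-graphs, joints and subjoints, the maximal subgraph (pp. 12–13);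
* immersions, excisions, proper morphisms, graph-coverings, finite graph-coverings (pp. 13–14);
* connectedness and trees.

## Rendering choices (recorded for the referee)

1. An edge "is a set of cardinality 2" whose elements are its branches, distinct edges being
   disjoint.  We keep ONE type `Branch` of all branches with a map `edgeOf : Branch → Edge` whose
   fibres have exactly two elements; this is literally the printed datum (a partition of the set
   of all branches into 2-element sets indexed by `ℰ`).
2. The coincidence map `ζ_e : e → 𝒱 ∪ {𝒱}` (the extra symbol `𝒱` meaning "abuts to no vertex")
   is `abuts : Branch → Option Vertex`, `none` playing the role of the symbol `𝒱`.
3. The paper regards a semi-graph "as a topological space" (pp. 11–12) and defines *connected*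
   and *tree* (= contractible, p. 13) topologically.  We render both combinatorially through the
   barycentric subdivision `SemiGraph.subdivision` (a `SimpleGraph` on vertices ⊔ edges ⊔
   branches: an edge-point is adjacent to its two branch-points, a branch-point to the vertex it
   abuts to), whose geometric realisation is that topological space with every non-abutting
   half-edge closed up (same homotopy type): `IsConnected` := the subdivision is connected,
   `IsTree` := the subdivision is a tree.  No topological space is constructed here.
4. A sub-semi-graph (p. 12, (a)–(c)) is identified with an arbitrary pair (set of vertices, set
   of edges): (b),(c) say exactly that its coincidence maps are the restrictions.

NOT here (companion files): compactification, `G[v]`, `G[e]`, `G[b]` and the observations of p. 14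
(`SemiGraphLocal.lean`); Galois graph-coverings, pull-backs, Prop. 1.1 ff. (`ZariskiMainTheorem`).
-/

namespace Literature.AnabelianGeometry.SemiGraphs

universe u

/-- A *semi-graph* `G = {𝒱, ℰ, ζ}` ([SemiAnbd] §1 p. 11): a set of vertices, a set of edges, each
edge `e` being a set of cardinality `2` (its *branches*; distinct edges are disjoint), and for each
edge a coincidence map `ζ_e : e → 𝒱 ∪ {𝒱}`.  Rendered with one type of branches fibred over the
edges with 2-element fibres, and `abuts b = none` for `ζ_e(b) = 𝒱` ("`b` abuts to no vertex").
[cite: MochizukiSemiAnbd2006, §1 p.11] -/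
structure SemiGraph : Type (u + 1) where
  /-- the set `𝒱` of vertices -/
  Vertex : Type u
  /-- the set `ℰ` of edges -/
  Edge : Type u
  /-- the set of all branches of all edges -/
  Branch : Type u
  /-- the edge of which a branch is an element -/
  edgeOf : Branch → Edge
  /-- the coincidence maps: the vertex a branch abuts to, if any -/
  abuts : Branch → Option Vertex
  /-- every edge is a set of cardinality precisely `2` -/
  two_branches : ∀ e : Edge, ∃ b₁ b₂ : Branch, b₁ ≠ b₂ ∧ edgeOf b₁ = e ∧ edgeOf b₂ = e ∧
    ∀ b : Branch, edgeOf b = e → b = b₁ ∨ b = b₂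

namespace SemiGraph

variable (G : SemiGraph.{u})

/-! ### Vertices, edges, branches (p. 11) -/

/-- The *verticial portion* `ζ_e⁻¹(𝒱) ⊆ e` of an edge: its branches that abut to some vertex.
[cite: MochizukiSemiAnbd2006, §1 p.11] -/
def verticialPortion (e : G.Edge) : Set G.Branch := {b | G.edgeOf b = e ∧ (G.abuts b).isSome}

/-- The *verticial cardinality* of an edge: the cardinality (`0`, `1` or `2`) of its verticial
portion. [cite: MochizukiSemiAnbd2006, §1 p.11] -/
noncomputable def vertCard (e : G.Edge) : ℕ := Nat.card (G.verticialPortion e)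

/-- A *graph* is a semi-graph all of whose edges have verticial cardinality precisely `2`, i.e.
every branch abuts to a vertex. [cite: MochizukiSemiAnbd2006, §1 p.11] -/
@[mk_iff] structure IsGraph : Prop where
  /-- every branch abuts to some vertex -/
  abuts_isSome : ∀ b : G.Branch, (G.abuts b).isSome

/-- A semi-graph is *finite* if both its set of vertices and its set of edges are finite.
[cite: MochizukiSemiAnbd2006, §1 p.11] -/
@[mk_iff] structure IsFinite : Prop where
  /-- finitely many vertices -/
  finite_vertex : Finite G.Vertex
  /-- finitely many edges -/
  finite_edge : Finite G.Edge

/-- A semi-graph is *countable* if both its set of vertices and its set of edges are countable.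
[cite: MochizukiSemiAnbd2006, §1 p.11] -/
@[mk_iff] structure IsCountable : Prop where
  /-- countably many vertices -/
  countable_vertex : Countable G.Vertex
  /-- countably many edges -/
  countable_edge : Countable G.Edge

/-- A *component* of a semi-graph is the datum of either a vertex or an edge.
[cite: MochizukiSemiAnbd2006, §1 p.11] -/
abbrev Component : Type u := G.Vertex ⊕ G.Edge

/-- The edge `e` *meets* or *abuts to* the vertex `v`: some branch of `e` abuts to `v`.
[cite: MochizukiSemiAnbd2006, §1 p.11] -/
def EdgeAbuts (e : G.Edge) (v : G.Vertex) : Prop := ∃ b : G.Branch, G.edgeOf b = e ∧ G.abuts b = some v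

/-- An edge `e` (of verticial cardinality `2`) *joins* `v₁` to `v₂` (not necessarily distinct): its two
branches abut to `v₁` and `v₂` respectively. [cite: MochizukiSemiAnbd2006, §1 p.11] -/
def Joins (e : G.Edge) (v₁ v₂ : G.Vertex) : Prop :=
  ∃ b₁ b₂ : G.Branch, b₁ ≠ b₂ ∧ G.edgeOf b₁ = e ∧ G.edgeOf b₂ = e ∧
    G.abuts b₁ = some v₁ ∧ G.abuts b₂ = some v₂

/-- The branches abutting to a vertex `v` (the "star" of `v`). [cite: MochizukiSemiAnbd2006, §1 p.13] -/
abbrev Star (v : G.Vertex) : Type u := {b : G.Branch // G.abuts b = some v}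

/-! ### Closed, open, isolated edges; coverticial edges; local finiteness (pp. 12–13) -/

/-- An edge is *closed* if its verticial cardinality is `2`. [cite: MochizukiSemiAnbd2006, §1 p.12] -/
def IsClosedEdge (e : G.Edge) : Prop := G.vertCard e = 2

/-- An edge is *open* if its verticial cardinality is `< 2`. [cite: MochizukiSemiAnbd2006, §1 p.12] -/
def IsOpenEdge (e : G.Edge) : Prop := G.vertCard e < 2

/-- An edge is *isolated* if its verticial cardinality is `0`. [cite: MochizukiSemiAnbd2006, §1 p.12] -/
def IsIsolatedEdge (e : G.Edge) : Prop := G.vertCard e = 0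

/-- Two closed edges `e`, `e'` are *coverticial* if `e` abuts to a vertex `v` iff `e'` abuts to `v`
(pp. 12–13). [cite: MochizukiSemiAnbd2006, §1 pp.12-13] -/
def Coverticial (e e' : G.Edge) : Prop :=
  G.IsClosedEdge e ∧ G.IsClosedEdge e' ∧ ∀ v : G.Vertex, G.EdgeAbuts e v ↔ G.EdgeAbuts e' v

/-- `G` is *locally finite* if for every vertex `v` the set of edges abutting to `v` is finite.
[cite: MochizukiSemiAnbd2006, §1 p.13] -/
@[mk_iff] structure IsLocallyFinite : Prop where
  /-- finitely many edges at each vertex -/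
  finite_edges : ∀ v : G.Vertex, Set.Finite {e : G.Edge | G.EdgeAbuts e v}

/-- `G` is *untangled* if every closed edge abuts to two *distinct* vertices.
[cite: MochizukiSemiAnbd2006, §1 p.13] -/
@[mk_iff] structure IsUntangled : Prop where
  /-- closed edges are not loops -/
  joins_ne : ∀ e : G.Edge, G.IsClosedEdge e → ∃ v₁ v₂ : G.Vertex, v₁ ≠ v₂ ∧ G.Joins e v₁ v₂

/-! ### Connectedness and trees via the barycentric subdivision (pp. 11–13) -/

/-- The points of the barycentric subdivision of the topological space associated to `G`
(pp. 11–12): one for each vertex, each edge (its midpoint) and each branch (the midpoint of the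
corresponding half-edge). [cite: MochizukiSemiAnbd2006, §1 pp.11-12] -/
abbrev Node : Type u := G.Vertex ⊕ (G.Edge ⊕ G.Branch)

/-- The incidence relation generating the subdivision of the topological space of pp. 11–12: an
edge-point is joined to the points of its two branches, and a branch-point to the vertex it abuts
to (if any). [cite: MochizukiSemiAnbd2006, §1 pp.11-12] -/
inductive NodeRel : G.Node → G.Node → Prop
  | edge_branch (b : G.Branch) : NodeRel (Sum.inr (Sum.inl (G.edgeOf b))) (Sum.inr (Sum.inr b))
  | branch_vertex (b : G.Branch) (v : G.Vertex) (h : G.abuts b = some v) :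
      NodeRel (Sum.inr (Sum.inr b)) (Sum.inl v)

/-- The barycentric subdivision of `G` as a simple graph on `G.Node`; its geometric realisation is
the topological space the paper associates to `G` (pp. 11–12) with the non-abutting half-edges
closed up — same connected components, same homotopy type.
[cite: MochizukiSemiAnbd2006, §1 pp.11-12] -/
def subdivision : SimpleGraph G.Node := SimpleGraph.fromRel G.NodeRel

/-- `G` is *connected*: its associated topological space is connected (and nonempty), rendered as
connectedness of the barycentric subdivision. [cite: MochizukiSemiAnbd2006, §1 pp.11-13] -/
@[mk_iff] structure IsConnected : Prop where
  /-- the barycentric subdivision is a connected simple graph -/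
  connected : G.subdivision.Connected

/-- `G` is a *tree*: its associated topological space is contractible (p. 13), rendered as: the
barycentric subdivision is a (connected, acyclic) tree. [cite: MochizukiSemiAnbd2006, §1 p.13] -/
@[mk_iff] structure IsTree : Prop where
  /-- the barycentric subdivision is a tree -/
  isTree : G.subdivision.IsTree

/-- A *joint*: a connected semi-graph with precisely one vertex and precisely two edges, both of
which are open. [cite: MochizukiSemiAnbd2006, §1 p.13] -/
@[mk_iff] structure IsJoint : Prop where
  /-- connected -/
  isConnected : G.IsConnected
  /-- precisely one vertex -/
  card_vertex : Nat.card G.Vertex = 1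
  /-- precisely two edges -/
  card_edge : Nat.card G.Edge = 2
  /-- both edges are open -/
  isOpenEdge : ∀ e : G.Edge, G.IsOpenEdge e

/-! ### Morphisms of semi-graphs (p. 11) -/

variable {G}

/-- A *morphism of semi-graphs* `G → G'` ([SemiAnbd] §1 p. 11): maps on vertices and on edges and,
for each edge `e ↦ e'`, a bijection `e ⥲ e'` of branches (equivalently an injection, both having
cardinality 2) — here one map of branches over the map of edges, injective on each edge — "all of
which are compatible with the verticial restrictions of the respective coincidence maps": a branch
abutting to `v` maps to a branch abutting to the image of `v`, while a branch abutting to no vertex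
may map to any branch. [cite: MochizukiSemiAnbd2006, §1 p.11] -/
@[ext] structure Hom (G G' : SemiGraph.{u}) : Type u where
  /-- the map `𝒱 → 𝒱'` -/
  vertexMap : G.Vertex → G'.Vertex
  /-- the map `ℰ → ℰ'` -/
  edgeMap : G.Edge → G'.Edge
  /-- the maps `e ⥲ e'`, assembled into one map of branches -/
  branchMap : G.Branch → G'.Branch
  /-- branches of `e` go to branches of the image of `e` -/
  edgeOf_branchMap : ∀ b : G.Branch, G'.edgeOf (branchMap b) = edgeMap (G.edgeOf b)
  /-- `e → e'` is injective (hence bijective) -/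
  branchMap_injOn : ∀ b₁ b₂ : G.Branch, G.edgeOf b₁ = G.edgeOf b₂ →
    branchMap b₁ = branchMap b₂ → b₁ = b₂
  /-- compatibility with the verticial restrictions of the coincidence maps -/
  abuts_branchMap : ∀ (b : G.Branch) (v : G.Vertex), G.abuts b = some v →
    G'.abuts (branchMap b) = some (vertexMap v)

namespace Hom

/-- The identity morphism of a semi-graph. [cite: MochizukiSemiAnbd2006, §1 p.11] -/
protected def id (G : SemiGraph.{u}) : Hom G G where
  vertexMap := id
  edgeMap := id
  branchMap := id
  edgeOf_branchMap _ := rfl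
  branchMap_injOn _ _ _ h := h
  abuts_branchMap _ _ h := h

/-- Composition of morphisms of semi-graphs. [cite: MochizukiSemiAnbd2006, §1 p.11] -/
protected def comp {G₁ G₂ G₃ : SemiGraph.{u}} (φ : Hom G₁ G₂) (ψ : Hom G₂ G₃) : Hom G₁ G₃ where
  vertexMap := ψ.vertexMap ∘ φ.vertexMap
  edgeMap := ψ.edgeMap ∘ φ.edgeMap
  branchMap := ψ.branchMap ∘ φ.branchMap
  edgeOf_branchMap b := by
    simp only [Function.comp_apply, ψ.edgeOf_branchMap, φ.edgeOf_branchMap]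
  branchMap_injOn b₁ b₂ he h :=
    φ.branchMap_injOn b₁ b₂ he (ψ.branchMap_injOn _ _ (by
      rw [φ.edgeOf_branchMap, φ.edgeOf_branchMap, he]) h)
  abuts_branchMap b v h := ψ.abuts_branchMap _ _ (φ.abuts_branchMap b v h)

end Hom

/-- Semi-graphs and their morphisms form a category. [cite: MochizukiSemiAnbd2006, §1 p.11] -/
instance : CategoryTheory.LargeCategory SemiGraph.{u} where
  Hom := Hom
  id := Hom.id
  comp := Hom.comp
  id_comp _ := rfl
  comp_id _ := rfl
  assoc _ _ _ := rfl

open CategoryTheory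

/-- Morphisms of semi-graphs are determined by their three maps (p. 11: a morphism "is a collection
of maps"). [cite: MochizukiSemiAnbd2006, §1 p.11] -/
@[ext] theorem hom_ext {G G' : SemiGraph.{u}} (φ ψ : G ⟶ G') (hv : φ.vertexMap = ψ.vertexMap)
    (he : φ.edgeMap = ψ.edgeMap) (hb : φ.branchMap = ψ.branchMap) : φ = ψ :=
  Hom.ext hv he hb

/-- The identity morphism is the identity on vertices. [cite: MochizukiSemiAnbd2006, §1 p.11] -/
@[simp] theorem id_vertexMap (G : SemiGraph.{u}) : (𝟙 G : G ⟶ G).vertexMap = id := rfl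
/-- The identity morphism is the identity on edges. [cite: MochizukiSemiAnbd2006, §1 p.11] -/
@[simp] theorem id_edgeMap (G : SemiGraph.{u}) : (𝟙 G : G ⟶ G).edgeMap = id := rfl
/-- The identity morphism is the identity on branches. [cite: MochizukiSemiAnbd2006, §1 p.11] -/
@[simp] theorem id_branchMap (G : SemiGraph.{u}) : (𝟙 G : G ⟶ G).branchMap = id := rfl
/-- Composition acts on vertices by composition. [cite: MochizukiSemiAnbd2006, §1 p.11] -/
@[simp] theorem comp_vertexMap {G₁ G₂ G₃ : SemiGraph.{u}} (φ : G₁ ⟶ G₂) (ψ : G₂ ⟶ G₃) :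
    (φ ≫ ψ).vertexMap = ψ.vertexMap ∘ φ.vertexMap := rfl
/-- Composition acts on edges by composition. [cite: MochizukiSemiAnbd2006, §1 p.11] -/
@[simp] theorem comp_edgeMap {G₁ G₂ G₃ : SemiGraph.{u}} (φ : G₁ ⟶ G₂) (ψ : G₂ ⟶ G₃) :
    (φ ≫ ψ).edgeMap = ψ.edgeMap ∘ φ.edgeMap := rfl
/-- Composition acts on branches by composition. [cite: MochizukiSemiAnbd2006, §1 p.11] -/
@[simp] theorem comp_branchMap {G₁ G₂ G₃ : SemiGraph.{u}} (φ : G₁ ⟶ G₂) (ψ : G₂ ⟶ G₃) :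
    (φ ≫ ψ).branchMap = ψ.branchMap ∘ φ.branchMap := rfl

/-- The map induced by a morphism on the branches abutting to a vertex `v` (into the branches
abutting to the image of `v`), used to define immersions and excisions (pp. 13–14).
[cite: MochizukiSemiAnbd2006, §1 pp.13-14] -/
def Hom.starMap {G G' : SemiGraph.{u}} (φ : G ⟶ G') (v : G.Vertex) :
    G.Star v → G'.Star (φ.vertexMap v) :=
  fun b => ⟨φ.branchMap b.1, φ.abuts_branchMap b.1 v b.2⟩

/-! ### Sub-semi-graphs and embeddings (p. 12) -/

variable (G)

/-- A *sub-semi-graph* `H` of `G` ([SemiAnbd] §1 p. 12, conditions (a)–(c)): a subset of the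
vertices and a subset of the edges (each edge coming with both of its branches); by (b),(c) its
coincidence maps are forced — a branch abuts, relative to `H`, to `v` iff it abuts to `v` relative
to `G` and `v` lies in `H`. [cite: MochizukiSemiAnbd2006, §1 p.12] -/
@[ext] structure Subgraph : Type u where
  /-- the vertices of the sub-semi-graph -/
  verts : Set G.Vertex
  /-- the edges of the sub-semi-graph -/
  edges : Set G.Edge

namespace Subgraph

variable {G} (H : G.Subgraph)

open Classical in
/-- The sub-semi-graph as a semi-graph in its own right: conditions (b),(c) of p. 12 define its
coincidence maps. [cite: MochizukiSemiAnbd2006, §1 p.12] -/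
noncomputable def toSemiGraph : SemiGraph.{u} where
  Vertex := H.verts
  Edge := H.edges
  Branch := {b : G.Branch // G.edgeOf b ∈ H.edges}
  edgeOf b := ⟨G.edgeOf b.1, b.2⟩
  abuts b := (G.abuts b.1).pbind fun v _ => if h : v ∈ H.verts then some ⟨v, h⟩ else none
  two_branches e := by
    obtain ⟨b₁, b₂, hne, h₁, h₂, hall⟩ := G.two_branches e.1
    refine ⟨⟨b₁, h₁ ▸ e.2⟩, ⟨b₂, h₂ ▸ e.2⟩, fun h => hne (congrArg Subtype.val h),
      Subtype.ext h₁, Subtype.ext h₂, fun b hb => ?_⟩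
    rcases hall b.1 (congrArg Subtype.val hb) with h | h
    · exact Or.inl (Subtype.ext h)
    · exact Or.inr (Subtype.ext h)

/-- The inclusion morphism of a sub-semi-graph. [cite: MochizukiSemiAnbd2006, §1 p.12] -/
noncomputable def ι : H.toSemiGraph ⟶ G where
  vertexMap := Subtype.val
  edgeMap := Subtype.val
  branchMap := Subtype.val
  edgeOf_branchMap _ := rfl
  branchMap_injOn _ _ _ h := Subtype.ext h
  abuts_branchMap b v h := by
    change (G.abuts b.1).pbind _ = some v at h
    cases hb : G.abuts b.1 with
    | none => simp [hb] at h
    | some w =>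
      simp only [hb, Option.pbind_some] at h
      split_ifs at h with hw
      cases h
      rfl

end Subgraph

/-- The *maximal subgraph* of a semi-graph: the sub-semi-graph obtained by omitting all of the open
edges. [cite: MochizukiSemiAnbd2006, §1 p.13] -/
def maximalSubgraph : G.Subgraph where
  verts := Set.univ
  edges := {e | G.IsClosedEdge e}

/-- A *subjoint* of `G`: a sub-semi-graph which is a joint. [cite: MochizukiSemiAnbd2006, §1 p.13] -/
def Subgraph.IsSubjoint {G : SemiGraph.{u}} (H : G.Subgraph) : Prop := H.toSemiGraph.IsJoint

variable {G}

/-- A morphism of semi-graphs is an *embedding* if it induces an isomorphism of the domain onto a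
sub-semi-graph of the codomain. [cite: MochizukiSemiAnbd2006, §1 p.12] -/
def IsEmbedding {G G' : SemiGraph.{u}} (φ : G ⟶ G') : Prop :=
  ∃ (H : G'.Subgraph) (i : G ≅ H.toSemiGraph), φ = i.hom ≫ H.ι

/-! ### Immersions, excisions, proper morphisms, graph-coverings (pp. 13–14) -/

/-- A morphism is an *immersion* (is *immersive*) if for every vertex `v_A ↦ v_B` the induced map
from branches abutting to `v_A` to branches abutting to `v_B` is injective.
[cite: MochizukiSemiAnbd2006, §1 pp.13-14] -/
def IsImmersion {G G' : SemiGraph.{u}} (φ : G ⟶ G') : Prop :=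
  ∀ v : G.Vertex, Function.Injective (Hom.starMap φ v)

/-- A morphism is an *excision* (is *excisive*) if for every vertex `v_A ↦ v_B` the induced map
from branches abutting to `v_A` to branches abutting to `v_B` is bijective.
[cite: MochizukiSemiAnbd2006, §1 pp.13-14] -/
def IsExcision {G G' : SemiGraph.{u}} (φ : G ⟶ G') : Prop :=
  ∀ v : G.Vertex, Function.Bijective (Hom.starMap φ v)

/-- Excisions are immersions. [cite: MochizukiSemiAnbd2006, §1 p.14] -/
theorem IsExcision.isImmersion {G G' : SemiGraph.{u}} {φ : G ⟶ G'} (h : IsExcision φ) :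
    IsImmersion φ :=
  fun v => (h v).injective

/-- A morphism is *proper* if it preserves verticial cardinalities of edges.
[cite: MochizukiSemiAnbd2006, §1 p.14] -/
def IsProper {G G' : SemiGraph.{u}} (φ : G ⟶ G') : Prop :=
  ∀ e : G.Edge, G'.vertCard (φ.edgeMap e) = G.vertCard e

/-- A *graph-covering* is a proper excision. [cite: MochizukiSemiAnbd2006, §1 p.14] -/
def IsGraphCovering {G G' : SemiGraph.{u}} (φ : G ⟶ G') : Prop := IsProper φ ∧ IsExcision φ

/-- A *finite graph-covering* is a graph-covering with finite fibres (on vertices and on edges).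
[cite: MochizukiSemiAnbd2006, §1 p.14] -/
def IsFiniteGraphCovering {G G' : SemiGraph.{u}} (φ : G ⟶ G') : Prop :=
  IsGraphCovering φ ∧ (∀ v' : G'.Vertex, Finite {v : G.Vertex // φ.vertexMap v = v'}) ∧
    ∀ e' : G'.Edge, Finite {e : G.Edge // φ.edgeMap e = e'}

/-- A finite graph-covering is a graph-covering. [cite: MochizukiSemiAnbd2006, §1 p.14] -/
theorem IsFiniteGraphCovering.isGraphCovering {G G' : SemiGraph.{u}} {φ : G ⟶ G'}
    (h : IsFiniteGraphCovering φ) : IsGraphCovering φ :=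
  h.1

end SemiGraph

end Literature.AnabelianGeometry.SemiGraphs
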